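import Literature.NumberTheory.LFunctions.ZetaOneLineRiemannSiegel
import HarnessLib

/-!
# Crude Riemann–Siegel bounds for Riemann's auxiliary function `𝓡(σ + it)`, uniform in `σ`

Topic `Literature/NumberTheory/LFunctions` (namespace
`Literature.NumberTheory.LFunctions.SiegelIntegral`). Everything here is PROVED; there are no
definitions and no named facts.

`ZetaOneLineRiemannSiegel.lean` bounds Siegel's integral `J_c(s) = −(1+i)∫ F_s(c + u(1+i)) du`
(`F_s(x) = x^{-s} e^{πix²}/(2i sin πx)`, saddle abscissa `c ≈ x₀ = √(t/2π)`) in terms of a *uniform*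
majorant `P` of the power `‖x‖^{-σ}` along the line, which exists only for `σ ≥ 0`. For
Levinson's method one needs `𝓡` (and its reflection `conj 𝓡(1 − s̄)`) in vertical strips reaching
into `σ < 0`, where `‖x‖^{-σ} = ‖x‖^{|σ|}` grows along the line. Here we run the same three-range
argument (Titchmarsh §4.16) with the majorant `‖x‖^{-σ} ≤ 2^{|σ|} c^{-σ} e^{|u|}` (valid as soon as
`c ≥ 2|σ|`), the factor `e^{|u|}` being absorbed by the decay `e^{−π|u|}` of `1/sin`:

* `rpow_neg_le_two_rpow_mul` — `y^{-σ} ≤ 2^{|σ|} x^{-σ}` whenever `x/2 ≤ y ≤ 2x`;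
* `rpow_norm_line_le_core`, `rpow_norm_line_le_tail` — the majorants of `‖(c + u(1+i))‖^{-σ}` for
  `|u| ≤ ½` and for all `u`;
* `integral_norm_rsKernel_le_of_le_exp` — the three-range bound with a tail majorant `P₂ e^{|u|}`:
  `∫ ‖F_s‖ du ≤ P₁ (25/28 + 3/(2π)) + P₂ (44/9)(0.18)`;
* `integral_norm_rsKernel_le_uniform` — `∫ ‖F_s(c + u(1+i))‖ du ≤ 3 · 2^{|σ|} c^{-σ}` for
  `Im s = 2πx₀²`, `x₀ ≥ 8`, `|c − x₀| ≤ ¼`, `dist(c, ℤ) ≥ ¼`, `2|σ| ≤ c`;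
* `norm_riemannAux_sub_sum_le` — **the main bound**: for `t ≥ 128π` and `|σ| ≤ x₀/4`,
  `‖𝓡(σ+it) − Σ_{n ≤ N} n^{-σ-it}‖ ≤ 5 · 4^{|σ|} x₀^{-σ}` (`x₀ = √(t/2π)`, `N = ⌊x₀⌋`);
* `norm_riemannAux_le_rpow` — polynomial growth `‖𝓡(σ+it)‖ ≤ 6 · 4^A x₀^{1+A}` for `|σ| ≤ A`;
* `norm_riemannAux_sub_one_le` — `‖𝓡(σ+it) − 1‖ ≤ 1/(σ−1) + 5 · 4^A x₀^{-3/2}` for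
  `3/2 ≤ σ ≤ A` (so `𝓡 → 1` only as `σ → ∞`; at fixed `σ > 2` the right side is `< 1`).

These are the inputs for the size of Conrey's function `V = 𝜙(−δ/L)𝓡 + χ 𝜙(1−δ/L)K` on the
edges of the rectangles of Levinson's method (Conrey, J. Number Theory 16 (1983), §4 (2)–(3)).

## References

* E. C. Titchmarsh, *The Theory of the Riemann Zeta-Function*, 2nd ed. (1986), §4.16.
  [Titchmarsh1986]
* C. L. Siegel, *Über Riemanns Nachlaß zur analytischen Zahlentheorie* (1932), §2. [Siegel1932]
* J. B. Conrey, *Zeros of derivatives of Riemann's ξ-function on the critical line*, J. Number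
  Theory 16 (1983), 49–74, §4. [Conrey1983]
-/

noncomputable section

open Complex MeasureTheory Set Filter Real
open scoped Topology

namespace Literature.NumberTheory.LFunctions

namespace SiegelIntegral

/-! ### Majorants of `y^{-σ}` uniform in the sign of `σ` -/

/-- If `x/2 ≤ y ≤ 2x` (`x > 0`) then `y^{-σ} ≤ 2^{|σ|} x^{-σ}` for every real `σ`. [folklore] -/
theorem rpow_neg_le_two_rpow_mul {x y σ : ℝ} (hx : 0 < x) (h1 : x / 2 ≤ y) (h2 : y ≤ 2 * x) :
    y ^ (-σ) ≤ (2 : ℝ) ^ |σ| * x ^ (-σ) := by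
  rcases le_or_gt 0 σ with hσ | hσ
  · -- `σ ≥ 0`: `y^{-σ} ≤ (x/2)^{-σ} = 2^σ x^{-σ}`
    have h : y ^ (-σ) ≤ (x / 2) ^ (-σ) := Real.rpow_le_rpow_of_nonpos (by positivity) h1 (by linarith)
    rw [abs_of_nonneg hσ]
    refine h.trans (le_of_eq ?_)
    rw [Real.div_rpow hx.le (by norm_num), Real.rpow_neg (by norm_num : (0 : ℝ) ≤ 2), div_eq_mul_inv,
      inv_inv, mul_comm]
  · -- `σ < 0`: `y^{-σ} ≤ (2x)^{-σ} = 2^{-σ} x^{-σ}`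
    have h : y ^ (-σ) ≤ (2 * x) ^ (-σ) := Real.rpow_le_rpow (by linarith) h2 (by linarith)
    rw [abs_of_neg hσ]
    refine h.trans (le_of_eq ?_)
    rw [Real.mul_rpow (by norm_num) hx.le]

/-- **Core majorant**: for `c ≥ 1` and `|u| ≤ ½`, `‖c + u(1+i)‖^{-σ} ≤ 2^{|σ|} c^{-σ}`
(`c/2 ≤ c − ½ ≤ Re x ≤ ‖x‖ ≤ c + 2|u| ≤ 2c`). [folklore] -/
theorem rpow_norm_line_le_core {c u : ℝ} (hc : 1 ≤ c) (hu : |u| ≤ 1 / 2) (σ : ℝ) :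
    ‖line c u‖ ^ (-σ) ≤ (2 : ℝ) ^ |σ| * c ^ (-σ) := by
  refine rpow_neg_le_two_rpow_mul (by linarith) ?_ ?_
  · refine le_trans ?_ (Complex.re_le_norm _)
    rw [line_re]; linarith [(abs_le.1 hu).1]
  · refine (norm_line_le c u).trans ?_
    rw [abs_of_pos (by linarith)]; linarith

/-- **Tail majorant**: for `c ≥ 1` with `2|σ| ≤ c`, and every `u`,
`‖c + u(1+i)‖^{-σ} ≤ 2^{|σ|} c^{-σ} e^{|u|}` (for `σ ≥ 0` from `‖x‖ ≥ c/√2`; for `σ < 0` from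
`‖x‖ ≤ c(1 + 2|u|/c)` and `(1 + 2|u|/c)^{|σ|} ≤ e^{2|σ||u|/c} ≤ e^{|u|}`). [folklore] -/
theorem rpow_norm_line_le_tail {c : ℝ} (hc : 1 ≤ c) {σ : ℝ} (hσ : 2 * |σ| ≤ c) (u : ℝ) :
    ‖line c u‖ ^ (-σ) ≤ (2 : ℝ) ^ |σ| * c ^ (-σ) * Real.exp |u| := by
  have hc0 : 0 < c := by linarith
  have h2σ : (1 : ℝ) ≤ (2 : ℝ) ^ |σ| := Real.one_le_rpow (by norm_num) (abs_nonneg σ)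
  have hcσ : 0 ≤ c ^ (-σ) := Real.rpow_nonneg hc0.le _
  have hexp1 : 1 ≤ Real.exp |u| := Real.one_le_exp (abs_nonneg u)
  rcases le_or_gt 0 σ with hσ0 | hσ0
  · -- `σ ≥ 0`
    have hlow : c / 2 ≤ ‖line c u‖ := by
      have h1 := half_sq_le_sq_norm_line c u
      have h2 : (c / 2) ^ 2 ≤ ‖line c u‖ ^ 2 := by nlinarith
      exact (sq_le_sq₀ (by positivity) (norm_nonneg _)).1 h2
    have h : ‖line c u‖ ^ (-σ) ≤ (c / 2) ^ (-σ) :=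
      Real.rpow_le_rpow_of_nonpos (by positivity) hlow (by linarith)
    have e : (c / 2) ^ (-σ) = (2 : ℝ) ^ |σ| * c ^ (-σ) := by
      rw [abs_of_nonneg hσ0, Real.div_rpow hc0.le (by norm_num), Real.rpow_neg (by norm_num : (0 : ℝ) ≤ 2),
        div_eq_mul_inv, inv_inv, mul_comm]
    calc ‖line c u‖ ^ (-σ) ≤ (2 : ℝ) ^ |σ| * c ^ (-σ) := h.trans e.le
      _ ≤ (2 : ℝ) ^ |σ| * c ^ (-σ) * Real.exp |u| :=
          le_mul_of_one_le_right (mul_nonneg (by positivity) hcσ) hexp1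
  · -- `σ < 0`
    have hτ : 0 < -σ := by linarith
    have habs : |σ| = -σ := abs_of_neg hσ0
    have hup : ‖line c u‖ ≤ c * (1 + 2 * |u| / c) := by
      have := norm_line_le c u
      rw [abs_of_pos hc0] at this
      have e : c * (1 + 2 * |u| / c) = c + 2 * |u| := by field_simp
      linarith [e]
    have h1 : ‖line c u‖ ^ (-σ) ≤ (c * (1 + 2 * |u| / c)) ^ (-σ) :=
      Real.rpow_le_rpow (norm_nonneg _) hup hτ.le
    have hy0 : 0 ≤ 1 + 2 * |u| / c := by positivity
    rw [Real.mul_rpow hc0.le hy0] at h1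
    -- `(1 + 2|u|/c)^{-σ} ≤ exp(2|u|/c)^{-σ} = exp(2|u|(-σ)/c) ≤ exp |u|`
    have h2 : (1 + 2 * |u| / c) ^ (-σ) ≤ Real.exp |u| := by
      have hle : 1 + 2 * |u| / c ≤ Real.exp (2 * |u| / c) := by
        have := Real.add_one_le_exp (2 * |u| / c); linarith
      calc (1 + 2 * |u| / c) ^ (-σ) ≤ (Real.exp (2 * |u| / c)) ^ (-σ) :=
            Real.rpow_le_rpow hy0 hle hτ.le
        _ = Real.exp (2 * |u| / c * (-σ)) := by rw [← Real.exp_mul]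
        _ ≤ Real.exp |u| := by
            rw [Real.exp_le_exp]
            have hq : 2 * (-σ) / c ≤ 1 := by
              rw [div_le_one hc0]; rw [habs] at hσ; exact hσ
            have : 2 * |u| / c * (-σ) = |u| * (2 * (-σ) / c) := by ring
            rw [this]
            exact mul_le_of_le_one_right (abs_nonneg u) hq
    calc ‖line c u‖ ^ (-σ) ≤ c ^ (-σ) * (1 + 2 * |u| / c) ^ (-σ) := h1
      _ ≤ c ^ (-σ) * Real.exp |u| := mul_le_mul_of_nonneg_left h2 hcσ
      _ = 1 * c ^ (-σ) * Real.exp |u| := by ring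
      _ ≤ (2 : ℝ) ^ |σ| * c ^ (-σ) * Real.exp |u| := by
          gcongr

/-! ### The three-range bound with an exponentially growing tail majorant -/

/-- **The saddle-point bound for general `s`, growing tail majorant** (crude form of Titchmarsh
§4.16 / Siegel §2): for `Im s = 2πx₀²`, `x₀ ≥ 8`, `|c − x₀| ≤ ¼`, `dist(c, ℤ) ≥ ¼`, if
`‖x‖^{-σ} ≤ P₁` for `|u| ≤ ½` and `‖x‖^{-σ} ≤ P₂ e^{|u|}` for `|u| > ½` along `x = c + u(1+i)`, then
`∫ ‖F_s(c + u(1+i))‖ du ≤ P₁ (25/28 + 3/(2π)) + P₂ (44/9)(0.18)`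
(core `½·(25/14)P₁`, middle `2·¼·(3/π)P₁`, tails `2·(22/9)P₂ e^{−(π−1)/2}/(π−1)` and
`e^{−(π−1)/2}/(π−1) ≤ 0.18`). [cite: Titchmarsh1986, §4.16] -/
theorem integral_norm_rsKernel_le_of_le_exp {x₀ c P₁ P₂ : ℝ} {s : ℂ} (ht : s.im = 2 * π * x₀ ^ 2)
    (hx₀ : 8 ≤ x₀) (hδ : |c - x₀| ≤ 1 / 4) (hd : ∀ n : ℤ, (1 : ℝ) / 4 ≤ |c - n|)
    (hP₁0 : 0 ≤ P₁) (hP₂0 : 0 ≤ P₂)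
    (hP₁ : ∀ u : ℝ, |u| ≤ 1 / 2 → ‖line c u‖ ^ (-s.re) ≤ P₁)
    (hP₂ : ∀ u : ℝ, 1 / 2 < |u| → ‖line c u‖ ^ (-s.re) ≤ P₂ * Real.exp |u|) :
    ∫ u : ℝ, ‖rsKernel s (line c u)‖ ≤ P₁ * (25 / 28 + 3 / (2 * π)) + P₂ * (44 / 9) * 0.18 := by
  have hπ := Real.pi_pos
  have hπ3 : 3.1415 < π := Real.pi_gt_d4
  have hπ4 : π < 3.1416 := Real.pi_lt_d4
  obtain ⟨hδ1, hδ2⟩ := abs_le.1 hδ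
  have hc0 : 0 < c := by linarith
  set g : ℝ → ℝ := fun u ↦ ‖rsKernel s (line c u)‖ with hg
  have hgi : Integrable g := (integrable_rsKernel_line s hc0 (by norm_num : (0 : ℝ) < 1 / 4) hd).norm
  have hg0 : ∀ u, 0 ≤ g u := fun u ↦ norm_nonneg _
  have hmid : ∀ (a b : ℝ) (M : ℝ), a ≤ b → (∀ u ∈ Ioc a b, g u ≤ M) →
      ∫ u in Ioc a b, g u ≤ M * (b - a) := by
    intro a b M hab hM
    have h1 : ∫ u in Ioc a b, g u ≤ ∫ _ in Ioc a b, M := by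
      refine integral_mono_of_nonneg ?_
        ((continuous_const.integrableOn_Icc (a := a) (b := b)).mono_set Set.Ioc_subset_Icc_self) ?_
      · exact Eventually.of_forall fun u ↦ hg0 u
      · exact (ae_restrict_iff' measurableSet_Ioc).2 (Eventually.of_forall hM)
    rw [setIntegral_const, Real.volume_real_Ioc_of_le hab, smul_eq_mul] at h1
    linarith
  -- the tail: rate `π - 1`
  set κ : ℝ := π - 1 with hκ
  have hκ0 : 0 < κ := by rw [hκ]; linarith
  have htail_pt : ∀ u : ℝ, 1 / 2 < |u| → g u ≤ P₂ * (22 / 9) * Real.exp (-(κ * |u|)) := by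
    intro u hu
    have h := norm_rsKernel_tail_of_le (u := u) ht hx₀ hδ hu (by positivity) (hP₂ u hu)
    have e : P₂ * Real.exp |u| * (22 / 9) * Real.exp (-(π * |u|)) = P₂ * (22 / 9) * Real.exp (-(κ * |u|)) := by
      rw [show -(κ * |u|) = |u| + -(π * |u|) by rw [hκ]; ring, Real.exp_add]; ring
    rw [← e]; exact h
  have htail : ∀ f : ℝ → ℝ, (∀ u, 0 ≤ f u) →
      (∀ u ∈ Ioi (1 / 2 : ℝ), f u ≤ P₂ * (22 / 9) * Real.exp (-(κ * u))) →
      ∫ u in Ioi (1 / 2 : ℝ), f u ≤ P₂ * (22 / 9) * (Real.exp (-(κ * (1 / 2))) / κ) := by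
    intro f hf0 hf
    have hexpi : IntegrableOn (fun u : ℝ ↦ P₂ * (22 / 9) * Real.exp (-κ * u)) (Ioi (1 / 2)) :=
      (integrableOn_exp_mul_Ioi (by linarith) _).const_mul _
    have h1 : ∫ u in Ioi (1 / 2 : ℝ), f u ≤
        ∫ u in Ioi (1 / 2 : ℝ), P₂ * (22 / 9) * Real.exp (-κ * u) := by
      refine integral_mono_of_nonneg (Eventually.of_forall fun u ↦ hf0 u) hexpi ?_
      refine (ae_restrict_iff' measurableSet_Ioi).2 (Eventually.of_forall fun u hu ↦ ?_)
      show f u ≤ P₂ * (22 / 9) * Real.exp (-κ * u)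
      rw [neg_mul]; exact hf u hu
    rw [MeasureTheory.integral_const_mul, integral_exp_mul_Ioi (by linarith) (1 / 2)] at h1
    rw [neg_mul] at h1
    have e : -Real.exp (-(κ * (1 / 2))) / -κ = Real.exp (-(κ * (1 / 2))) / κ := by
      rw [neg_div_neg_eq]
    rwa [e] at h1
  have hsplit1 := (intervalIntegral.integral_Iic_add_Ioi (b := -(1 / 2 : ℝ)) hgi.integrableOn
    hgi.integrableOn).symm
  have hunion : ∀ a b : ℝ, a ≤ b → ∫ u in Ioi a, g u = (∫ u in Ioc a b, g u) + ∫ u in Ioi b, g u := by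
    intro a b hab
    rw [← setIntegral_union Set.Ioc_disjoint_Ioi_same measurableSet_Ioi hgi.integrableOn
      hgi.integrableOn, Set.Ioc_union_Ioi_eq_Ioi hab]
  have hleft : ∫ u in Iic (-(1 / 2 : ℝ)), g u ≤ P₂ * (22 / 9) * (Real.exp (-(κ * (1 / 2))) / κ) := by
    rw [← integral_comp_neg_Ioi]
    · refine htail (fun u ↦ g (-u)) (fun u ↦ hg0 _) fun u hu ↦ ?_
      have hu0 : (0 : ℝ) < u := by linarith [hu.out]
      have hu' : (1 : ℝ) / 2 < |(-u)| := by rw [abs_neg, abs_of_pos hu0]; exact hu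
      have h := htail_pt (-u) hu'
      rw [abs_neg, abs_of_pos hu0] at h
      exact h
  have hright : ∫ u in Ioi (1 / 2 : ℝ), g u ≤ P₂ * (22 / 9) * (Real.exp (-(κ * (1 / 2))) / κ) := by
    refine htail g hg0 fun u hu ↦ ?_
    have hu0 : (0 : ℝ) < u := by linarith [hu.out]
    have hu' : (1 : ℝ) / 2 < |u| := by rw [abs_of_pos hu0]; exact hu
    have h := htail_pt u hu'
    rw [abs_of_pos hu0] at h
    exact h
  have hm1 : ∫ u in Ioc (-(1 / 2 : ℝ)) (-(1 / 4)), g u ≤ P₁ * (3 / π) * (-(1 / 4) - -(1 / 2 : ℝ)) :=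
    hmid _ _ _ (by norm_num) fun u hu ↦ by
      have h1 : (1 : ℝ) / 4 ≤ |u| := by rw [abs_of_neg (by linarith [hu.2])]; linarith [hu.2]
      have h2 : |u| ≤ 1 / 2 := by rw [abs_of_neg (by linarith [hu.2])]; linarith [hu.1]
      exact norm_rsKernel_mid_of_le ht hx₀ hδ h1 h2 hP₁0 (hP₁ u h2)
  have hm2 : ∫ u in Ioc (-(1 / 4 : ℝ)) (1 / 4), g u ≤ P₁ * (25 / 14) * (1 / 4 - -(1 / 4 : ℝ)) :=
    hmid _ _ _ (by norm_num) fun u hu ↦ by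
      have h1 : |u| ≤ 1 / 4 := abs_le.2 ⟨hu.1.le, hu.2⟩
      exact norm_rsKernel_core_of_le ht hx₀ hδ hd h1 hP₁0 (hP₁ u (by linarith))
  have hm3 : ∫ u in Ioc ((1 / 4 : ℝ)) (1 / 2), g u ≤ P₁ * (3 / π) * (1 / 2 - (1 / 4 : ℝ)) :=
    hmid _ _ _ (by norm_num) fun u hu ↦ by
      have h1 : (1 : ℝ) / 4 ≤ |u| := by rw [abs_of_pos (by linarith [hu.1])]; exact hu.1.le
      have h2 : |u| ≤ 1 / 2 := by rw [abs_of_pos (by linarith [hu.1])]; exact hu.2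
      exact norm_rsKernel_mid_of_le ht hx₀ hδ h1 h2 hP₁0 (hP₁ u h2)
  -- `e^{-κ/2}/κ ≤ 0.18`: `e^{κ/2} ≥ 1 + κ/2 + κ²/8 ≥ 2.64` and `κ ≥ 2.1415`
  have hexp : Real.exp (-(κ * (1 / 2))) / κ ≤ 0.18 := by
    have hκ1 : 2.1415 ≤ κ := by rw [hκ]; linarith
    have h1 : 2.64 ≤ Real.exp (κ * (1 / 2)) := by
      have := Real.quadratic_le_exp_of_nonneg (x := κ * (1 / 2)) (by positivity)
      nlinarith
    rw [Real.exp_neg, div_le_iff₀ hκ0, inv_eq_one_div, div_le_iff₀ (Real.exp_pos _)]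
    nlinarith [mul_le_mul hκ1 h1 (by norm_num) hκ0.le]
  rw [hsplit1, hunion _ _ (by norm_num : (-(1 / 2 : ℝ)) ≤ -(1 / 4)),
    hunion _ _ (by norm_num : (-(1 / 4 : ℝ)) ≤ 1 / 4), hunion _ _ (by norm_num : ((1 / 4 : ℝ)) ≤ 1 / 2)]
  have e1 : P₁ * (3 / π) * (-(1 / 4) - -(1 / 2 : ℝ)) + P₁ * (25 / 14) * (1 / 4 - -(1 / 4 : ℝ)) +
      P₁ * (3 / π) * (1 / 2 - (1 / 4 : ℝ)) = P₁ * (25 / 28 + 3 / (2 * π)) := by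
    field_simp; ring
  have e2 : P₂ * (22 / 9) * (Real.exp (-(κ * (1 / 2))) / κ) ≤ P₂ * (22 / 9) * 0.18 :=
    mul_le_mul_of_nonneg_left hexp (by positivity)
  nlinarith

/-- **`∫ ‖F_s(c + u(1+i))‖ du ≤ 3 · 2^{|σ|} c^{-σ}`** for `Im s = 2πx₀²`, `x₀ ≥ 8`, `|c − x₀| ≤ ¼`,
`dist(c, ℤ) ≥ ¼` and `2|Re s| ≤ c` (the power along the line is majorised by
`2^{|σ|} c^{-σ}` on the core and by `2^{|σ|} c^{-σ} e^{|u|}` on the tails, and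
`25/28 + 3/(2π) + (44/9)(0.18) ≤ 3`). [cite: Titchmarsh1986, §4.16] -/
theorem integral_norm_rsKernel_le_uniform {x₀ c : ℝ} {s : ℂ} (ht : s.im = 2 * π * x₀ ^ 2)
    (hx₀ : 8 ≤ x₀) (hδ : |c - x₀| ≤ 1 / 4) (hd : ∀ n : ℤ, (1 : ℝ) / 4 ≤ |c - n|)
    (hσ : 2 * |s.re| ≤ c) :
    ∫ u : ℝ, ‖rsKernel s (line c u)‖ ≤ 3 * (2 : ℝ) ^ |s.re| * c ^ (-s.re) := by
  have hπ3 : 3.1415 < π := Real.pi_gt_d4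
  obtain ⟨hδ1, hδ2⟩ := abs_le.1 hδ
  have hc1 : 1 ≤ c := by linarith
  set P : ℝ := (2 : ℝ) ^ |s.re| * c ^ (-s.re) with hP
  have hP0 : 0 ≤ P := mul_nonneg (by positivity) (Real.rpow_nonneg (by linarith) _)
  have h := integral_norm_rsKernel_le_of_le_exp ht hx₀ hδ hd hP0 hP0
    (fun u hu ↦ rpow_norm_line_le_core hc1 hu s.re) (fun u _ ↦ rpow_norm_line_le_tail hc1 hσ u)
  have hq : (3 : ℝ) / (2 * π) ≤ 0.4775 := by
    rw [div_le_iff₀ (by positivity)]; nlinarith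
  have : P * (25 / 28 + 3 / (2 * π)) + P * (44 / 9) * 0.18 ≤ 3 * P := by nlinarith
  linarith

/-! ### The main bound for `𝓡(σ + it)` -/

/-- `‖1 + i‖ = √2 ≤ 1.4143`. [folklore] -/
theorem norm_one_add_I_le : ‖(1 : ℂ) + I‖ ≤ 1.4143 := by
  have hn : ‖(1 : ℂ) + I‖ = Real.sqrt 2 := by
    have := Complex.norm_add_mul_I 1 1
    simp only [ofReal_one, one_mul] at this
    rw [this]; norm_num
  rw [hn, Real.sqrt_le_left (by norm_num)]; norm_num

/-- **Crude Riemann–Siegel bound, uniform in `σ`**: for `t ≥ 128π`, `x₀ = √(t/2π)`,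
`N = ⌊x₀⌋` and `|σ| ≤ x₀/4`,
`‖𝓡(σ + it) − Σ_{n=1}^{N} n^{-(σ+it)}‖ ≤ 5 · 4^{|σ|} · x₀^{-σ}`
(residue shift to the clamped saddle abscissa `c`, `|c − x₀| ≤ ¼`, then
`‖J_c(s)‖ ≤ √2 · 3 · 2^{|σ|} c^{-σ}` and `c^{-σ} ≤ 2^{|σ|} x₀^{-σ}`). [cite: Titchmarsh1986, §4.16] -/
theorem norm_riemannAux_sub_sum_le {σ t : ℝ} (ht : 128 * π ≤ t)
    (hσ : |σ| ≤ Real.sqrt (t / (2 * π)) / 4) :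
    ‖riemannAux (σ + t * I) -
        ∑ n ∈ Finset.Icc 1 ⌊Real.sqrt (t / (2 * π))⌋₊, ((n : ℂ)) ^ (-((σ : ℂ) + t * I))‖ ≤
      5 * (4 : ℝ) ^ |σ| * Real.sqrt (t / (2 * π)) ^ (-σ) := by
  have hπ := Real.pi_pos
  have hπ3 : 3.1415 < π := Real.pi_gt_d4
  have ht0 : 0 < t := by nlinarith
  set x₀ : ℝ := Real.sqrt (t / (2 * π)) with hx₀def
  have hx₀sq : x₀ ^ 2 = t / (2 * π) := by
    rw [hx₀def]; exact Real.sq_sqrt (div_nonneg ht0.le (by positivity))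
  have ht' : t = 2 * π * x₀ ^ 2 := by rw [hx₀sq]; field_simp
  have hx₀ : 8 ≤ x₀ := by
    rw [hx₀def, Real.le_sqrt (by norm_num) (div_nonneg ht0.le (by positivity))]
    rw [le_div_iff₀ (by positivity)]; nlinarith
  have hx₀0 : 0 < x₀ := by linarith
  set N : ℕ := ⌊x₀⌋₊ with hNdef
  set c : ℝ := max ((N : ℝ) + 1 / 4) (min x₀ (N + 3 / 4)) with hcdef
  obtain ⟨hN8, hc1, hc2, hδ, hd, hNle⟩ := clamp_props hx₀ hNdef hcdef
  obtain ⟨hδ1, hδ2⟩ := abs_le.1 hδ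
  set s : ℂ := σ + t * I with hsdef
  have hsre : s.re = σ := by simp [hsdef]
  have hsim : s.im = 2 * π * x₀ ^ 2 := by rw [← ht']; simp [hsdef]
  have h2 := riemannAux_eq_sum_add_rsLineIntegral s (N := N) (by omega) (c := c) (by linarith)
    (by linarith)
  have hσc : 2 * |s.re| ≤ c := by rw [hsre]; linarith
  have hJ : ‖rsLineIntegral c s‖ ≤ 1.4143 * (3 * (2 : ℝ) ^ |σ| * c ^ (-σ)) := by
    rw [rsLineIntegral, norm_mul, norm_neg]
    refine mul_le_mul norm_one_add_I_le ?_ (norm_nonneg _) (by norm_num)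
    refine (norm_integral_le_integral_norm _).trans ?_
    have := integral_norm_rsKernel_le_uniform hsim hx₀ hδ hd hσc
    rwa [hsre] at this
  have hcx : c ^ (-σ) ≤ (2 : ℝ) ^ |σ| * x₀ ^ (-σ) :=
    rpow_neg_le_two_rpow_mul hx₀0 (by linarith) (by linarith)
  have h4 : (2 : ℝ) ^ |σ| * (2 : ℝ) ^ |σ| = (4 : ℝ) ^ |σ| := by
    rw [← Real.mul_rpow (by norm_num) (by norm_num)]; norm_num
  have hdiff : riemannAux s - ∑ n ∈ Finset.Icc 1 N, ((n : ℂ)) ^ (-s) = rsLineIntegral c s := by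
    rw [h2]; ring
  rw [hdiff]
  have h2σ : (0 : ℝ) ≤ (2 : ℝ) ^ |σ| := by positivity
  calc ‖rsLineIntegral c s‖ ≤ 1.4143 * (3 * (2 : ℝ) ^ |σ| * c ^ (-σ)) := hJ
    _ ≤ 1.4143 * (3 * (2 : ℝ) ^ |σ| * ((2 : ℝ) ^ |σ| * x₀ ^ (-σ))) := by gcongr
    _ = 4.2429 * (4 : ℝ) ^ |σ| * x₀ ^ (-σ) := by rw [← h4]; ring
    _ ≤ 5 * (4 : ℝ) ^ |σ| * x₀ ^ (-σ) := by
        have : 0 ≤ (4 : ℝ) ^ |σ| * x₀ ^ (-σ) := mul_nonneg (by positivity) (Real.rpow_nonneg hx₀0.le _)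
        nlinarith

/-! ### Consequences: polynomial growth in strips, and `𝓡 ≈ 1` far to the right -/

/-- The norm of the main sum: `‖Σ_{n=1}^{N} n^{-s}‖ ≤ Σ_{n=1}^{N} n^{-Re s}`. [folklore] -/
theorem norm_sum_cpow_neg_le (s : ℂ) (N : ℕ) :
    ‖∑ n ∈ Finset.Icc 1 N, ((n : ℂ)) ^ (-s)‖ ≤ ∑ n ∈ Finset.Icc 1 N, (n : ℝ) ^ (-s.re) := by
  refine (norm_sum_le _ _).trans (le_of_eq (Finset.sum_congr rfl fun n hn ↦ ?_))
  rw [Complex.norm_natCast_cpow_of_pos (by simp at hn; omega), neg_re]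

/-- `Σ_{n=1}^{N} n^{-σ} ≤ N^{1+A}` for `|σ| ≤ A` and `N ≥ 1` (each term is `≤ n^{A} ≤ N^{A}`).
[folklore] -/
theorem sum_rpow_neg_le_pow {σ A : ℝ} (hσ : |σ| ≤ A) {N : ℕ} (hN : 1 ≤ N) :
    ∑ n ∈ Finset.Icc 1 N, (n : ℝ) ^ (-σ) ≤ (N : ℝ) ^ (1 + A) := by
  have hA : 0 ≤ A := (abs_nonneg σ).trans hσ
  have hN0 : (1 : ℝ) ≤ N := by exact_mod_cast hN
  have hterm : ∀ n ∈ Finset.Icc 1 N, (n : ℝ) ^ (-σ) ≤ (N : ℝ) ^ A := by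
    intro n hn
    simp only [Finset.mem_Icc] at hn
    have hn1 : (1 : ℝ) ≤ n := by exact_mod_cast hn.1
    have hnN : (n : ℝ) ≤ N := by exact_mod_cast hn.2
    calc (n : ℝ) ^ (-σ) ≤ (n : ℝ) ^ A :=
          Real.rpow_le_rpow_of_exponent_le hn1 (by linarith [neg_abs_le σ, (abs_le.1 (show |σ| ≤ A from hσ)).1])
      _ ≤ (N : ℝ) ^ A := Real.rpow_le_rpow (by linarith) hnN hA
  calc ∑ n ∈ Finset.Icc 1 N, (n : ℝ) ^ (-σ) ≤ ∑ n ∈ Finset.Icc 1 N, (N : ℝ) ^ A :=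
        Finset.sum_le_sum hterm
    _ = N * (N : ℝ) ^ A := by simp
    _ = (N : ℝ) ^ (1 + A) := by
        rw [Real.rpow_add (by linarith), Real.rpow_one]

/-- **Polynomial growth of `𝓡` in vertical strips**: for `|σ| ≤ A`, `t ≥ 128π` and `A ≤ x₀/4`
(`x₀ = √(t/2π)`), `‖𝓡(σ + it)‖ ≤ 6 · 4^A · x₀^{1+A}`. [cite: Titchmarsh1986, §4.16] -/
theorem norm_riemannAux_le_rpow {σ A t : ℝ} (hσ : |σ| ≤ A) (ht : 128 * π ≤ t)
    (hA : A ≤ Real.sqrt (t / (2 * π)) / 4) :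
    ‖riemannAux (σ + t * I)‖ ≤ 6 * (4 : ℝ) ^ A * Real.sqrt (t / (2 * π)) ^ (1 + A) := by
  have hπ := Real.pi_pos
  have hπ3 : 3.1415 < π := Real.pi_gt_d4
  have ht0 : 0 < t := by nlinarith
  have hA0 : 0 ≤ A := (abs_nonneg σ).trans hσ
  set x₀ : ℝ := Real.sqrt (t / (2 * π)) with hx₀def
  have hx₀ : 8 ≤ x₀ := by
    rw [hx₀def, Real.le_sqrt (by norm_num) (div_nonneg ht0.le (by positivity))]
    rw [le_div_iff₀ (by positivity)]; nlinarith
  have hx₀1 : 1 ≤ x₀ := by linarith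
  set N : ℕ := ⌊x₀⌋₊ with hNdef
  have hN8 : 8 ≤ N := by rw [hNdef]; exact Nat.le_floor (by exact_mod_cast hx₀)
  have hNle : (N : ℝ) ≤ x₀ := by rw [hNdef]; exact Nat.floor_le (by linarith)
  have hmain := norm_riemannAux_sub_sum_le (σ := σ) ht (hσ.trans hA)
  set s : ℂ := σ + t * I with hsdef
  have hsre : s.re = σ := by simp [hsdef]
  -- the main sum
  have hsum : ‖∑ n ∈ Finset.Icc 1 N, ((n : ℂ)) ^ (-s)‖ ≤ x₀ ^ (1 + A) := by
    refine (norm_sum_cpow_neg_le s N).trans ?_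
    rw [hsre]
    refine (sum_rpow_neg_le_pow hσ (by omega)).trans ?_
    exact Real.rpow_le_rpow (by positivity) hNle (by linarith)
  -- the remainder: `4^{|σ|} x₀^{-σ} ≤ 4^A x₀^{A} ≤ 4^A x₀^{1+A}`
  have hrem : 5 * (4 : ℝ) ^ |σ| * x₀ ^ (-σ) ≤ 5 * (4 : ℝ) ^ A * x₀ ^ (1 + A) := by
    have h1 : (4 : ℝ) ^ |σ| ≤ (4 : ℝ) ^ A := Real.rpow_le_rpow_of_exponent_le (by norm_num) hσ
    have h2 : x₀ ^ (-σ) ≤ x₀ ^ (1 + A) :=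
      Real.rpow_le_rpow_of_exponent_le hx₀1 (by linarith [neg_le_abs σ, hσ])
    gcongr
  have h1A : (1 : ℝ) ≤ (4 : ℝ) ^ A := Real.one_le_rpow (by norm_num) hA0
  have hxpos : 0 ≤ x₀ ^ (1 + A) := by positivity
  calc ‖riemannAux s‖ = ‖(riemannAux s - ∑ n ∈ Finset.Icc 1 N, ((n : ℂ)) ^ (-s)) +
        ∑ n ∈ Finset.Icc 1 N, ((n : ℂ)) ^ (-s)‖ := by rw [sub_add_cancel]
    _ ≤ ‖riemannAux s - ∑ n ∈ Finset.Icc 1 N, ((n : ℂ)) ^ (-s)‖ +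
        ‖∑ n ∈ Finset.Icc 1 N, ((n : ℂ)) ^ (-s)‖ := norm_add_le _ _
    _ ≤ 5 * (4 : ℝ) ^ A * x₀ ^ (1 + A) + x₀ ^ (1 + A) := add_le_add (hmain.trans hrem) hsum
    _ ≤ 6 * (4 : ℝ) ^ A * x₀ ^ (1 + A) := by nlinarith [mul_le_mul_of_nonneg_right h1A hxpos]

/-- `Σ_{n=2}^{N} n^{-σ} ≤ 1/(σ − 1)` for `σ > 1` (comparison with `∫_1^N x^{-σ} dx`). [folklore] -/
theorem sum_Icc_two_rpow_neg_le {σ : ℝ} (hσ : 1 < σ) (N : ℕ) :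
    ∑ n ∈ Finset.Icc 2 N, (n : ℝ) ^ (-σ) ≤ 1 / (σ - 1) := by
  rcases lt_or_ge N 2 with hN | hN
  · rw [Finset.Icc_eq_empty_of_lt hN, Finset.sum_empty]; exact div_nonneg zero_le_one (by linarith)
  -- `Σ_{i ∈ Ico 1 N} f(i+1) ≤ ∫_1^N f`
  have h1N : (1 : ℕ) ≤ N := by omega
  have hN1 : (1 : ℝ) ≤ N := by exact_mod_cast h1N
  have hanti : AntitoneOn (fun x : ℝ ↦ x ^ (-σ)) (Icc ((1 : ℕ) : ℝ) N) := by
    intro x hx y hy hxy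
    rw [Nat.cast_one] at hx
    exact Real.rpow_le_rpow_of_nonpos (by linarith [hx.1]) hxy (by linarith)
  have hcmp := AntitoneOn.sum_le_integral_Ico h1N hanti
  rw [Nat.cast_one] at hcmp
  -- reindex the sum
  have hre : ∑ n ∈ Finset.Icc 2 N, (n : ℝ) ^ (-σ) = ∑ i ∈ Finset.Ico 1 N, ((i + 1 : ℕ) : ℝ) ^ (-σ) := by
    have : Finset.Icc 2 N = (Finset.Ico 1 N).map ⟨fun i ↦ i + 1, add_left_injective 1⟩ := by
      ext m
      simp only [Finset.mem_Icc, Finset.mem_map, Finset.mem_Ico, Function.Embedding.coeFn_mk]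
      constructor
      · rintro ⟨h1, h2⟩; exact ⟨m - 1, ⟨by omega, by omega⟩, by omega⟩
      · rintro ⟨k, ⟨h1, h2⟩, rfl⟩; exact ⟨by omega, by omega⟩
    rw [this, Finset.sum_map]
    rfl
  rw [hre]
  refine hcmp.trans ?_
  -- `∫_1^N x^{-σ} = (N^{1-σ} - 1)/(1-σ) ≤ 1/(σ-1)`
  rw [integral_rpow (Or.inr ⟨by linarith, by
    intro h0; have := (Set.mem_uIcc.1 h0); rcases this with h | h <;> linarith [h.1, h.2]⟩)]
  have hpow : (0 : ℝ) ≤ (N : ℝ) ^ (-σ + 1) := by positivity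
  have hq : ((N : ℝ) ^ (-σ + 1) - 1 ^ (-σ + 1)) / (-σ + 1) = (1 - (N : ℝ) ^ (-σ + 1)) * (1 / (σ - 1)) := by
    rw [Real.one_rpow]
    have h1 : (-σ + 1) ≠ 0 := by intro h; linarith
    have h2 : (σ - 1) ≠ 0 := by intro h; linarith
    field_simp
    ring
  rw [hq]
  exact mul_le_of_le_one_left (div_nonneg zero_le_one (by linarith)) (by linarith)

/-- **`𝓡 ≈ 1` far to the right**: for `3/2 ≤ σ ≤ A`, `t ≥ 128π` and `A ≤ x₀/4` (`x₀ = √(t/2π)`),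
`‖𝓡(σ + it) − 1‖ ≤ 1/(σ − 1) + 5 · 4^A · x₀^{-3/2}` (the terms `n ≥ 2` of the main sum contribute
at most `Σ_{n≥2} n^{-σ} ≤ 1/(σ−1)`, Siegel's integral at most `5 · 4^{σ} x₀^{-σ}`).
[cite: Titchmarsh1986, §4.16] -/
theorem norm_riemannAux_sub_one_le {σ A t : ℝ} (hσ : 3 / 2 ≤ σ) (hσA : σ ≤ A) (ht : 128 * π ≤ t)
    (hA : A ≤ Real.sqrt (t / (2 * π)) / 4) :
    ‖riemannAux (σ + t * I) - 1‖ ≤ 1 / (σ - 1) + 5 * (4 : ℝ) ^ A * Real.sqrt (t / (2 * π)) ^ (-(3 / 2 : ℝ)) := by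
  have hπ := Real.pi_pos
  have hπ3 : 3.1415 < π := Real.pi_gt_d4
  have ht0 : 0 < t := by nlinarith
  have hσabs : |σ| = σ := abs_of_pos (by linarith)
  set x₀ : ℝ := Real.sqrt (t / (2 * π)) with hx₀def
  have hx₀ : 8 ≤ x₀ := by
    rw [hx₀def, Real.le_sqrt (by norm_num) (div_nonneg ht0.le (by positivity))]
    rw [le_div_iff₀ (by positivity)]; nlinarith
  have hx₀1 : 1 ≤ x₀ := by linarith
  set N : ℕ := ⌊x₀⌋₊ with hNdef
  have hN8 : 8 ≤ N := by rw [hNdef]; exact Nat.le_floor (by exact_mod_cast hx₀)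
  have hmain := norm_riemannAux_sub_sum_le (σ := σ) ht (by rw [hσabs]; exact hσA.trans hA)
  set s : ℂ := σ + t * I with hsdef
  have hsre : s.re = σ := by simp [hsdef]
  -- split off `n = 1`
  have h1N : 1 ≤ N := by omega
  have hsplit : ∑ n ∈ Finset.Icc 1 N, ((n : ℂ)) ^ (-s) = 1 + ∑ n ∈ Finset.Icc 2 N, ((n : ℂ)) ^ (-s) := by
    have hI : Finset.Icc 2 N = Finset.Ioc 1 N :=
      show Finset.Icc (1 + 1) N = _ from Finset.Icc_add_one_left_eq_Ioc 1 N
    rw [hI, Finset.Icc_eq_cons_Ioc h1N, Finset.sum_cons]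
    simp
  have htail : ‖∑ n ∈ Finset.Icc 2 N, ((n : ℂ)) ^ (-s)‖ ≤ 1 / (σ - 1) := by
    calc ‖∑ n ∈ Finset.Icc 2 N, ((n : ℂ)) ^ (-s)‖ ≤ ∑ n ∈ Finset.Icc 2 N, ‖((n : ℂ)) ^ (-s)‖ :=
          norm_sum_le _ _
      _ = ∑ n ∈ Finset.Icc 2 N, (n : ℝ) ^ (-σ) := by
          refine Finset.sum_congr rfl fun n hn ↦ ?_
          rw [Complex.norm_natCast_cpow_of_pos (by simp at hn; omega), neg_re, hsre]
      _ ≤ 1 / (σ - 1) := sum_Icc_two_rpow_neg_le (by linarith) N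
  have hrem : 5 * (4 : ℝ) ^ |σ| * x₀ ^ (-σ) ≤ 5 * (4 : ℝ) ^ A * x₀ ^ (-(3 / 2 : ℝ)) := by
    have h1 : (4 : ℝ) ^ |σ| ≤ (4 : ℝ) ^ A := Real.rpow_le_rpow_of_exponent_le (by norm_num) (by rwa [hσabs])
    have h2 : x₀ ^ (-σ) ≤ x₀ ^ (-(3 / 2 : ℝ)) := Real.rpow_le_rpow_of_exponent_le hx₀1 (by linarith)
    have h3 : 0 ≤ x₀ ^ (-σ) := by positivity
    gcongr
  calc ‖riemannAux s - 1‖ = ‖(riemannAux s - ∑ n ∈ Finset.Icc 1 N, ((n : ℂ)) ^ (-s)) +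
        ∑ n ∈ Finset.Icc 2 N, ((n : ℂ)) ^ (-s)‖ := by rw [hsplit]; ring_nf
    _ ≤ ‖riemannAux s - ∑ n ∈ Finset.Icc 1 N, ((n : ℂ)) ^ (-s)‖ +
        ‖∑ n ∈ Finset.Icc 2 N, ((n : ℂ)) ^ (-s)‖ := norm_add_le _ _
    _ ≤ 5 * (4 : ℝ) ^ A * x₀ ^ (-(3 / 2 : ℝ)) + 1 / (σ - 1) := add_le_add (hmain.trans hrem) htail
    _ = 1 / (σ - 1) + 5 * (4 : ℝ) ^ A * x₀ ^ (-(3 / 2 : ℝ)) := by ring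

end SiegelIntegral

end Literature.NumberTheory.LFunctions

end
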